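import Mathlib
import HarnessLib
import Summits.Langlands.Langlands.Theses.RamifiedCoefficientSeed
import Literature.NumberTheory.GaloisRepresentations.CrystallineOrdinaryShape

/-!
# Tenure sketch (strategist evidence, NOT installed): the ORDINARY re-type of
# `RamifiedCoefficientSeed` removes the pinned-datum block from the whole route

Crux-strategist seat `planner-cstrat-stmt-Langlands-16778-s1-0`, 2026-08-17, on crux stmt-Langlands-16778
`ExplicitRamifiedFamily` (h1 of `closes`).  Companion of `STRATEGY-CENSUS.md` §5 and of the registered
`--alt` line `Lines/ordinary_transfer.lean`.  Everything here is sorry-free logic over existing declarations.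

* `OrdGenAt p ρ v` — the honest, datum-free local condition ORD-GEN(0,1,2) at `v ∣ p` (the tree's
  `FramedRep.IsCrystallineOrdinaryOfShape` with shape `(0,1,2)`, inlined, plus pairwise distinct unramified
  diagonal parts).  `ordGenAt_isCrystallineOrdinaryOfShapeAt` : it implies the tree's named predicate.
* `ExplicitRamifiedFamilyOrd` — h1 with conjunct (C) "pinned-crystalline + labelled weights {0,1,2}"
  replaced by `OrdGenAt`; `AdjointLiftingGL3Ord` — h3 with its crystalline hypothesis replaced by `OrdGenAt`
  (the setting of ACCGHLNSTT2023 Thm 6.1.2, ordinary automorphy lifting, `p > n`).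
* `closesOrd : ExplicitRamifiedFamilyOrd → AdjointSeedFromDuality → AdjointLiftingGL3Ord → SectorComplement →
  Langlands` — same proof shape as the route's `closes`: the re-typed route still literally decides the summit,
  and NO item mentions `IsCrystallineFramed` in positive position any more.
* `PinnedComparison` — the transfer stub of the alt line as a route-level Prop (the missing Upgrade-path
  clause), with `explicitRamifiedFamily_of_ord` : `ExplicitRamifiedFamilyOrd → PinnedComparison →
  ExplicitRamifiedFamily` and `adjointLiftingGL3Ord_of` : `AdjointLiftingGL3 → PinnedComparison →
  AdjointLiftingGL3Ord` — i.e. modulo the (true, D2-blocked) clause the two typings are interchangeable, so the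
  re-type loses nothing and gains decidability.
-/

set_option linter.dupNamespace false

noncomputable section

namespace Summit.Langlands.Langlands.Cruxes.ExplicitRamifiedFamily.RetypeOrdinary

open Summit.Langlands.Langlands.Theses.RamifiedCoefficientSeed
open Literature.NumberTheory.GaloisRepresentations
open Filter IsDedekindDomain
open scoped NumberField MatrixGroups

/-- ORD-GEN(0,1,2) at `v ∣ p` for `ρ : Γ_ℚ → GL₃(ℚ̄_p)`: a triangular frame with inertial diagonal
`ε⁰, ε⁻¹, ε⁻²` and pairwise distinct unramified diagonal parts `M_{ii}·εⁱ`. [cite: Greenberg1991, §2] -/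
def OrdGenAt (p : ℕ) [Fact p.Prime]
    (ρ : Literature.NumberTheory.GaloisRepresentations.FramedGaloisRep ℚ (PadicAlgCl p) 3)
    (v : IsDedekindDomain.HeightOneSpectrum (NumberField.RingOfIntegers ℚ)) : Prop :=
  (∃ g : GL (Fin 3) (PadicAlgCl p),
          (∀ (τ : Field.absoluteGaloisGroup (v.adicCompletion ℚ)) (i j : Fin 3), j < i →
              ((g * ρ.toLocal v τ * g⁻¹ : GL (Fin 3) (PadicAlgCl p)) :
                Matrix (Fin 3) (Fin 3) (PadicAlgCl p)) i j = 0) ∧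
          (∀ τ ∈ absInertia (v.adicCompletion ℚ), ∀ i : Fin 3,
              ((g * ρ.toLocal v τ * g⁻¹ : GL (Fin 3) (PadicAlgCl p)) :
                Matrix (Fin 3) (Fin 3) (PadicAlgCl p)) i i =
                algebraMap ℚ_[p] (PadicAlgCl p)
                  ((((GaloisRep.cyclotomicCharacter (v.adicCompletion ℚ) p τ)⁻¹ : ℤ_[p]ˣ) :
                    ℤ_[p]) : ℚ_[p]) ^ (i : ℕ)) ∧
          (∀ i j : Fin 3, i ≠ j → ∃ τ : Field.absoluteGaloisGroup (v.adicCompletion ℚ),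
              ((g * ρ.toLocal v τ * g⁻¹ : GL (Fin 3) (PadicAlgCl p)) :
                Matrix (Fin 3) (Fin 3) (PadicAlgCl p)) i i *
                  algebraMap ℚ_[p] (PadicAlgCl p)
                    ((((GaloisRep.cyclotomicCharacter (v.adicCompletion ℚ) p τ) : ℤ_[p]ˣ) :
                      ℤ_[p]) : ℚ_[p]) ^ (i : ℕ) ≠
              ((g * ρ.toLocal v τ * g⁻¹ : GL (Fin 3) (PadicAlgCl p)) :
                Matrix (Fin 3) (Fin 3) (PadicAlgCl p)) j j *
                  algebraMap ℚ_[p] (PadicAlgCl p)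
                    ((((GaloisRep.cyclotomicCharacter (v.adicCompletion ℚ) p τ) : ℤ_[p]ˣ) :
                      ℤ_[p]) : ℚ_[p]) ^ (j : ℕ)))

/-- ORD-GEN(0,1,2) implies the tree's `IsCrystallineOrdinaryOfShapeAt v ρ ![0,1,2]` (drop genericity).
[folklore] -/
theorem ordGenAt_isCrystallineOrdinaryOfShapeAt (p : ℕ) [Fact p.Prime]
    (ρ : Literature.NumberTheory.GaloisRepresentations.FramedGaloisRep ℚ (PadicAlgCl p) 3)
    (v : IsDedekindDomain.HeightOneSpectrum (NumberField.RingOfIntegers ℚ)) (h : OrdGenAt p ρ v) :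
    ρ.IsCrystallineOrdinaryOfShapeAt v ![0, 1, 2] := by
  obtain ⟨g, htri, hdiag, _⟩ := h
  refine ⟨g, htri, fun τ hτ i => ?_⟩
  rw [hdiag τ hτ i]
  congr 1
  fin_cases i <;> rfl

/-- **h1 re-typed**: the explicit family with ORD-GEN(0,1,2) at `p` in place of the pinned-crystalline
clause (every other conjunct verbatim). [cite: VangeemenTop1994, §1] [cite: ACCGHLNSTT2023, Thm 6.1.2] -/
def ExplicitRamifiedFamilyOrd : Prop :=
  ∃ (p : ℕ) (_ : Fact p.Prime), 11 ≤ p ∧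
    ∃ f : ℕ → Literature.NumberTheory.GaloisRepresentations.FramedGaloisRep ℚ (PadicAlgCl p) 3,
      (∀ m n, m ≠ n → ¬ ∃ χ : Literature.NumberTheory.GaloisRepresentations.FramedGaloisRep ℚ (PadicAlgCl p) 1,
          ∀ σ, (f m σ).val.trace = (χ σ).val 0 0 * (f n σ).val.trace) ∧
      ∀ n,
        (¬ ∃ χ : Literature.NumberTheory.GaloisRepresentations.FramedGaloisRep ℚ (PadicAlgCl p) 1,
            ∀ σ, (f n σ⁻¹).val.trace = (χ σ).val 0 0 * (f n σ).val.trace) ∧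
        (∀ᶠ v : IsDedekindDomain.HeightOneSpectrum (NumberField.RingOfIntegers ℚ) in Filter.cofinite,
            (f n).IsUnramifiedAt v) ∧
        (∀ (v : IsDedekindDomain.HeightOneSpectrum (NumberField.RingOfIntegers ℚ))
            (_hv : ((p : ℕ) : NumberField.RingOfIntegers ℚ) ∈ v.asIdeal), OrdGenAt p (f n) v) ∧
        (∃ ν : Literature.NumberTheory.GaloisRepresentations.FramedGaloisRep ℚ (PadicAlgCl p) 1,
            ∀ σ, ‖(f n σ).val.trace - (ν σ).val 0 0 * (f n σ⁻¹).val.trace‖ < 1) ∧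
        ((f n).restrictField (CyclotomicField p ℚ)).IsResiduallyAbsIrreducible ∧
        (∃ (φ : ℚ →+* ℝ) (c : Field.absoluteGaloisGroup ℚ),
            Literature.NumberTheory.GaloisRepresentations.IsComplexConjugation φ c ∧
              (((f n) c).val.trace = 1 ∨ ((f n) c).val.trace = -1))

/-- **h3 re-typed on the ORDINARY branch** (ACC+ Thm 6.1.2 setting): `p ≥ 11`, `ρ` unramified a.e.,
ORD-GEN(0,1,2) at every `v ∣ p`, `ρ̄|ℚ(ζ_p)` absolutely irreducible, odd adjoint seed ⇒ cuspidal
L-algebraic `π` with Satake–Frobenius matching a.e. [cite: ACCGHLNSTT2023, Thm 6.1.2] -/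
def AdjointLiftingGL3Ord : Prop :=
  ∀ (p : ℕ) [Fact p.Prime], 11 ≤ p →
    ∀ ρ : Literature.NumberTheory.GaloisRepresentations.FramedGaloisRep ℚ (PadicAlgCl p) 3,
      (∀ᶠ v : IsDedekindDomain.HeightOneSpectrum (NumberField.RingOfIntegers ℚ) in Filter.cofinite,
          ρ.IsUnramifiedAt v) →
      (∀ (v : IsDedekindDomain.HeightOneSpectrum (NumberField.RingOfIntegers ℚ))
          (_hv : ((p : ℕ) : NumberField.RingOfIntegers ℚ) ∈ v.asIdeal), OrdGenAt p ρ v) →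
      (ρ.restrictField (CyclotomicField p ℚ)).IsResiduallyAbsIrreducible →
      (∃ (ρ₀ : Literature.NumberTheory.GaloisRepresentations.FramedGaloisRep ℚ (PadicAlgCl p) 2)
          (η : Literature.NumberTheory.GaloisRepresentations.FramedGaloisRep ℚ (PadicAlgCl p) 1),
          ρ₀.IsOdd ∧ ∀ σ, ‖(ρ σ).val.trace - (η σ).val 0 0 *
            ((ρ₀ σ).val.trace ^ 2 * ((ρ₀ σ).val.det)⁻¹ - 1)‖ < 1) →
      ∀ (ι : PadicAlgCl p ≃+* ℂ)
        (hcpt : Literature.NumberTheory.Automorphic.isCompact_glFiniteIntegralLevel 3 ℚ),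
        ∃ π : Literature.NumberTheory.Automorphic.CuspidalAutomorphicRepData 3 ℚ hcpt,
          π.1.IsLAlgebraic ∧
            ∀ᶠ v : IsDedekindDomain.HeightOneSpectrum (NumberField.RingOfIntegers ℚ) in Filter.cofinite,
              Summit.Langlands.SatakeFrobCompatibleAt ι π.1 ρ v

/-- **The re-typed route still literally decides the summit** (same proof shape as `closes`). [folklore] -/
theorem closesOrd (h1 : ExplicitRamifiedFamilyOrd) (h2 : AdjointSeedFromDuality) (h3 : AdjointLiftingGL3Ord)
    (h4 : SectorComplement) : _root_.Langlands := by
  refine h4 ?_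
  obtain ⟨p, hp, h11, f, hne, hf⟩ := h1
  refine ⟨p, hp, h11, f, hne, fun n => (hf n).1, fun n ι hcpt => ?_⟩
  obtain ⟨_, hunr, hord, hdual, hirr, hcc⟩ := hf n
  exact h3 p h11 (f n) hunr hord hirr (h2 p (le_trans (by norm_num) h11) (f n) hdual hirr hcc) ι hcpt

/-- **The missing comparison clause as a route-level Prop** (= stub 2 of `Lines/ordinary_transfer.lean`):
ORD-GEN(0,1,2) at `v ∣ p` ⇒ pinned-crystalline with labelled weights `{0,1,2}`.  True for Fontaine's datum
(Perrin-Riou + `φ`-eigenvalue genericity); unprovable before D2. [cite: PerrinRiou1994Ordinaires, Exposé IV] -/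
def PinnedComparison : Prop :=
  ∀ (p : ℕ) [Fact p.Prime]
    (ρ : Literature.NumberTheory.GaloisRepresentations.FramedGaloisRep ℚ (PadicAlgCl p) 3)
    (v : IsDedekindDomain.HeightOneSpectrum (NumberField.RingOfIntegers ℚ))
    (hv : ((p : ℕ) : NumberField.RingOfIntegers ℚ) ∈ v.asIdeal),
    OrdGenAt p ρ v →
      let D := Literature.NumberTheory.PAdicHodge.fontainePstAdicCompletion v p hv
      D.IsCrystallineFramed (ρ.toLocal v) ∧
        (letI := D.algebra
         ∀ τ : v.adicCompletion ℚ →ₐ[ℚ_[p]] PadicAlgCl p,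
           ρ.labelledHodgeTateWeightsAt v D.algebra D.𝔅 τ.toRingHom = {0, 1, 2})

/-- Modulo the comparison clause, the re-typed h1 gives the crux as typed. [folklore] -/
theorem explicitRamifiedFamily_of_ord (h : ExplicitRamifiedFamilyOrd) (hc : PinnedComparison) :
    ExplicitRamifiedFamily := by
  obtain ⟨p, hp, h11, f, hne, hf⟩ := h
  refine ⟨p, hp, h11, f, hne, fun n => ?_⟩
  obtain ⟨hnsd, hunr, hord, hdual, hirr, hcc⟩ := hf n
  exact ⟨hnsd, hunr, fun v hv => hc p (f n) v hv (hord v hv), hdual, hirr, hcc⟩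

/-- Modulo the comparison clause, the crux's consumer h3 AS TYPED gives the ordinary consumer: the re-typed
route is implied by the current one plus the clause. [folklore] -/
theorem adjointLiftingGL3Ord_of (h : AdjointLiftingGL3) (hc : PinnedComparison) : AdjointLiftingGL3Ord := by
  intro p _ h11 ρ hunr hord hirr hseed ι hcpt
  exact h p h11 ρ hunr (fun v hv => hc p ρ v hv (hord v hv)) hirr hseed ι hcpt

end Summit.Langlands.Langlands.Cruxes.ExplicitRamifiedFamily.RetypeOrdinary

end
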